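import Literature.Computability.Complexity.ParallelRepetitionProduct
import HarnessLib

/-!
# Isomorphisms of projection games: transport of value and satisfiability, products, powers

Topic `Computability/Complexity`, namespace `Literature.Computability.Complexity.ProjGame`.
Bookkeeping for the tree's proof of the NP-hardness of gap label cover (Dinur–Steurer 2014, §3.3):
the analytic bound `val(G^{⊗k}) ≤ (1 - ε)^{k/2}` (`ParallelRepetitionProduct.lean`,
`ConstraintGraphGame.lean`) lives on nested-tuple types `NProd`, while the list-level label cover
instances (`LabelCover.lean`) are indexed by `Fin N`; the two are connected by ISOMORPHISMS of
projection games — bijections of edges, vertices and labels compatible with `src`, `dst`, `proj`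
and the weights — along which the value and satisfiability are invariant.

* `Iso G G'` — the structure; `Iso.refl`, `Iso.symm`, `Iso.trans`;
* `Iso.total_eq`, `Iso.satW_eq` — total weight and satisfied weight correspond under the induced
  bijection of strategies; `Iso.valLe_iff` — `val(G) ≤ θ ↔ val(G') ≤ θ`; `Iso.sat_iff` — perfect
  strategies correspond;
* `Iso.prod`, `Iso.pow` — isomorphisms are compatible with the product `⊗` and the powers `G^{⊗k}`
  of `ParallelRepetitionProduct.lean` (Dinur–Steurer §2.2).

## References

* I. Dinur, D. Steurer, *Analytical approach to parallel repetition*, STOC 2014; arXiv:1305.1979,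
  §2.1–2.2 (games, the product `G ⊗ H`), §3.3.
-/

namespace Literature.Computability.Complexity

open Finset

namespace ProjGame

variable {E V U β α : Type} {E' V' U' β' α' : Type} {E'' V'' U'' β'' α'' : Type}

/-- An **isomorphism of projection games**: bijections of edges, Bob's and Alice's vertices and labels
that commute with `src`, `dst`, the projections and the weights. [cite: DinurSteurer2014, §2.1 (a game is the data (U, V, E, μ, π))] -/
structure Iso (G : ProjGame E V U β α) (G' : ProjGame E' V' U' β' α') where
  /-- the bijection of edges -/
  eE : E ≃ E'
  /-- the bijection of Bob's vertices -/
  eV : V ≃ V'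
  /-- the bijection of Alice's vertices -/
  eU : U ≃ U'
  /-- the bijection of Bob's labels -/
  eβ : β ≃ β'
  /-- the bijection of Alice's labels -/
  eα : α ≃ α'
  /-- compatibility with `src` -/
  src_eq : ∀ e, G'.src (eE e) = eV (G.src e)
  /-- compatibility with `dst` -/
  dst_eq : ∀ e, G'.dst (eE e) = eU (G.dst e)
  /-- compatibility with the projections -/
  proj_eq : ∀ e b, G'.proj (eE e) (eβ b) = (G.proj e b).map eα
  /-- compatibility with the weights -/
  wt_eq : ∀ e, G'.wt (eE e) = G.wt e

namespace Iso

variable {G : ProjGame E V U β α} {G' : ProjGame E' V' U' β' α'} {G'' : ProjGame E'' V'' U'' β'' α''}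

/-- The identity isomorphism. [folklore] -/
def refl (G : ProjGame E V U β α) : Iso G G where
  eE := Equiv.refl E
  eV := Equiv.refl V
  eU := Equiv.refl U
  eβ := Equiv.refl β
  eα := Equiv.refl α
  src_eq _ := rfl
  dst_eq _ := rfl
  proj_eq e b := by simp
  wt_eq _ := rfl

/-- The inverse isomorphism. [folklore] -/
def symm (h : Iso G G') : Iso G' G where
  eE := h.eE.symm
  eV := h.eV.symm
  eU := h.eU.symm
  eβ := h.eβ.symm
  eα := h.eα.symm
  src_eq e' := by
    rw [Equiv.eq_symm_apply, ← h.src_eq, Equiv.apply_symm_apply]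
  dst_eq e' := by
    rw [Equiv.eq_symm_apply, ← h.dst_eq, Equiv.apply_symm_apply]
  proj_eq e' b' := by
    have hp := h.proj_eq (h.eE.symm e') (h.eβ.symm b')
    rw [Equiv.apply_symm_apply, Equiv.apply_symm_apply] at hp
    rw [hp, Option.map_map, Equiv.symm_comp_self, Option.map_id, id]
  wt_eq e' := by
    rw [← h.wt_eq, Equiv.apply_symm_apply]

/-- Composition of isomorphisms. [folklore] -/
def trans (h : Iso G G') (h' : Iso G' G'') : Iso G G'' where
  eE := h.eE.trans h'.eE
  eV := h.eV.trans h'.eV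
  eU := h.eU.trans h'.eU
  eβ := h.eβ.trans h'.eβ
  eα := h.eα.trans h'.eα
  src_eq e := by simp [h'.src_eq, h.src_eq]
  dst_eq e := by simp [h'.dst_eq, h.dst_eq]
  proj_eq e b := by
    simp only [Equiv.trans_apply]
    rw [h'.proj_eq, h.proj_eq, Option.map_map]
    rfl
  wt_eq e := by simp [h'.wt_eq, h.wt_eq]

/-! ### Transport of total weight, satisfied weight, value, satisfiability -/

section Transport

variable [Fintype E] [Fintype E'] [DecidableEq α] [DecidableEq α']

omit [DecidableEq α] [DecidableEq α'] in
/-- Isomorphic games have the same total weight. [folklore] -/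
theorem total_eq (h : Iso G G') : G'.total = G.total := by
  unfold total
  rw [← Equiv.sum_comp h.eE]
  exact Fintype.sum_congr _ _ h.wt_eq

/-- The strategies of `G'` induced by strategies `(b, a)` of `G` along `h`. [folklore] -/
def mapB (h : Iso G G') (b : V → β) : V' → β' := fun v' => h.eβ (b (h.eV.symm v'))

/-- The strategies of `G'` induced by strategies `(b, a)` of `G` along `h` (Alice). [folklore] -/
def mapA (h : Iso G G') (a : U → α) : U' → α' := fun u' => h.eα (a (h.eU.symm u'))

omit [Fintype E] [Fintype E'] [DecidableEq α] [DecidableEq α'] in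
/-- An edge of `G'` is satisfied by the induced strategies iff the corresponding edge of `G` is. [folklore] -/
theorem sat_edge_iff (h : Iso G G') (b : V → β) (a : U → α) (e : E) :
    G'.proj (h.eE e) (h.mapB b (G'.src (h.eE e))) = some (h.mapA a (G'.dst (h.eE e))) ↔
      G.proj e (b (G.src e)) = some (a (G.dst e)) := by
  unfold mapB mapA
  rw [h.src_eq, h.dst_eq, Equiv.symm_apply_apply, Equiv.symm_apply_apply, h.proj_eq]
  cases G.proj e (b (G.src e)) with
  | none => simp
  | some x => simp

/-- **Satisfied weight is invariant**: `satW_{G'} (induced strategies) = satW_G (b, a)`. [cite: DinurSteurer2014, §2.1 (value of a game)] -/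
theorem satW_eq (h : Iso G G') (b : V → β) (a : U → α) : G'.satW (h.mapB b) (h.mapA a) = G.satW b a := by
  unfold satW
  rw [← Equiv.sum_comp h.eE]
  refine Fintype.sum_congr _ _ fun e => ?_
  rw [h.wt_eq]
  by_cases hs : G.proj e (b (G.src e)) = some (a (G.dst e))
  · rw [if_pos hs, if_pos ((h.sat_edge_iff b a e).2 hs)]
  · rw [if_neg hs, if_neg (fun h' => hs ((h.sat_edge_iff b a e).1 h'))]

omit [Fintype E] [Fintype E'] [DecidableEq α] [DecidableEq α'] in
/-- Every strategy of `G'` (Bob) is induced from one of `G`. [folklore] -/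
theorem mapB_surj (h : Iso G G') (b' : V' → β') : h.mapB (fun v => h.eβ.symm (b' (h.eV v))) = b' := by
  funext v'
  simp [mapB]

omit [Fintype E] [Fintype E'] [DecidableEq α] [DecidableEq α'] in
/-- Every strategy of `G'` (Alice) is induced from one of `G`. [folklore] -/
theorem mapA_surj (h : Iso G G') (a' : U' → α') : h.mapA (fun u => h.eα.symm (a' (h.eU u))) = a' := by
  funext u'
  simp [mapA]

/-- **The value is invariant**: `val(G) ≤ θ ↔ val(G') ≤ θ`. [cite: DinurSteurer2014, §2.1 (value of a game)] -/
theorem valLe_iff (h : Iso G G') (θ : ℝ) : G.ValLe θ ↔ G'.ValLe θ := by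
  constructor
  · intro hv b' a'
    rw [← h.mapB_surj b', ← h.mapA_surj a', h.satW_eq, h.total_eq]
    exact hv _ _
  · intro hv b a
    rw [← h.satW_eq, ← h.total_eq]
    exact hv _ _

omit [Fintype E] [Fintype E'] [DecidableEq α] [DecidableEq α'] in
/-- **Perfect strategies correspond**. [cite: DinurSteurer2014, §3.3 ("if val(G) = 1 …")] -/
theorem sat_iff (h : Iso G G') :
    (∃ (b : V → β) (a : U → α), ∀ e, G.proj e (b (G.src e)) = some (a (G.dst e))) ↔
      ∃ (b' : V' → β') (a' : U' → α'), ∀ e', G'.proj e' (b' (G'.src e')) = some (a' (G'.dst e')) := by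
  constructor
  · rintro ⟨b, a, hba⟩
    refine ⟨h.mapB b, h.mapA a, fun e' => ?_⟩
    obtain ⟨e, rfl⟩ := h.eE.surjective e'
    exact (h.sat_edge_iff b a e).2 (hba e)
  · rintro ⟨b', a', hba⟩
    refine ⟨fun v => h.eβ.symm (b' (h.eV v)), fun u => h.eα.symm (a' (h.eU u)), fun e => ?_⟩
    have h1 := hba (h.eE e)
    rw [← h.mapB_surj b', ← h.mapA_surj a'] at h1
    exact (h.sat_edge_iff _ _ e).1 h1

end Transport

/-! ### Products and powers -/

section Prod

variable [Fintype E] [Fintype V] [Fintype U] [Fintype β] [Fintype α]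
  [DecidableEq V] [DecidableEq U] [DecidableEq β] [DecidableEq α]
variable [Fintype E'] [Fintype V'] [Fintype U'] [Fintype β'] [Fintype α']
  [DecidableEq V'] [DecidableEq U'] [DecidableEq β'] [DecidableEq α']
variable {F X Y σ τ : Type} [Fintype F] [Fintype X] [Fintype Y] [Fintype σ] [Fintype τ]
  [DecidableEq X] [DecidableEq Y] [DecidableEq σ] [DecidableEq τ]
variable {F' X' Y' σ' τ' : Type} [Fintype F'] [Fintype X'] [Fintype Y'] [Fintype σ'] [Fintype τ']
  [DecidableEq X'] [DecidableEq Y'] [DecidableEq σ'] [DecidableEq τ']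
variable {H : ProjGame F X Y σ τ} {H' : ProjGame F' X' Y' σ' τ'}

omit [Fintype β] [Fintype α] [DecidableEq β] [DecidableEq α] [Fintype β'] [Fintype α'] [DecidableEq β'] [DecidableEq α']
  [Fintype σ] [Fintype τ] [DecidableEq σ] [DecidableEq τ] [Fintype σ'] [Fintype τ'] [DecidableEq σ'] [DecidableEq τ'] in
/-- The product constraint commutes with relabelling. [cite: DinurSteurer2014, §2.2] -/
theorem prodProj_map (π : β → Option α) (π' : σ → Option τ) (eα : α ≃ α') (eτ : τ ≃ τ') (b : β × σ) :
    prodProj (fun x => (π x).map eα) (fun y => (π' y).map eτ) b = (prodProj π π' b).map (eα.prodCongr eτ) := by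
  unfold prodProj
  rcases hx : π b.1 with _ | x
  · simp [hx]
  · rcases hy : π' b.2 with _ | y
    · simp [hx, hy]
    · simp [hx, hy]

/-- **Isomorphisms multiply**: `G ≅ G'` and `H ≅ H'` give `G ⊗ H ≅ G' ⊗ H'`. [cite: DinurSteurer2014, §2.2 (the product G ⊗ H)] -/
def prod (h : Iso G G') (h₂ : Iso H H') : Iso (G.prod H) (G'.prod H') where
  eE := h.eE.prodCongr h₂.eE
  eV := h.eV.prodCongr h₂.eV
  eU := h.eU.prodCongr h₂.eU
  eβ := h.eβ.prodCongr h₂.eβ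
  eα := h.eα.prodCongr h₂.eα
  src_eq e := by
    show (G'.src (h.eE e.1), H'.src (h₂.eE e.2)) = (h.eV (G.src e.1), h₂.eV (H.src e.2))
    rw [h.src_eq, h₂.src_eq]
  dst_eq e := by
    show (G'.dst (h.eE e.1), H'.dst (h₂.eE e.2)) = (h.eU (G.dst e.1), h₂.eU (H.dst e.2))
    rw [h.dst_eq, h₂.dst_eq]
  proj_eq e b := by
    show prodProj (G'.proj (h.eE e.1)) (H'.proj (h₂.eE e.2)) (h.eβ b.1, h₂.eβ b.2) =
      (prodProj (G.proj e.1) (H.proj e.2) b).map (h.eα.prodCongr h₂.eα)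
    rw [← prodProj_map]
    unfold prodProj
    simp only [h.proj_eq, h₂.proj_eq]
  wt_eq e := by
    show G'.wt (h.eE e.1) * H'.wt (h₂.eE e.2) = G.wt e.1 * H.wt e.2
    rw [h.wt_eq, h₂.wt_eq]

end Prod

section Pow

variable [Fintype E] [Fintype V] [Fintype U] [Fintype β] [Fintype α]
  [DecidableEq V] [DecidableEq U] [DecidableEq β] [DecidableEq α]
variable [Fintype E'] [Fintype V'] [Fintype U'] [Fintype β'] [Fintype α']
  [DecidableEq V'] [DecidableEq U'] [DecidableEq β'] [DecidableEq α']

/-- **Isomorphisms pass to powers**: `G ≅ G'` gives `G^{⊗k} ≅ G'^{⊗k}`. [cite: DinurSteurer2014, §2.2] -/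
def pow (h : Iso G G') : (k : ℕ) → Iso (G.pow k) (G'.pow k)
  | 0 => Iso.refl _
  | k + 1 => h.prod (pow h k)

end Pow

end Iso

end ProjGame

end Literature.Computability.Complexity
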